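import Mathlib.Geometry.Manifold.SmoothEmbedding
import Mathlib.Geometry.Manifold.ContMDiff.Atlas
import Mathlib.Geometry.Manifold.ContMDiff.NormedSpace
import Mathlib.Geometry.Manifold.ContMDiff.Constructions
import HarnessLib

/-!
# Criteria for immersions and smooth embeddings (local diffeomorphisms, zero sections, inverses)

Mathlib defines `C^n` immersions `Manifold.IsImmersionAt(OfComplement)` by the existence of charts
in the maximal atlases in which the map reads `u ↦ L (u, 0)`, and lists as TODO
(`Mathlib/Geometry/Manifold/Immersion.lean`, `SmoothEmbedding.lean`) that local diffeomorphisms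
and diffeomorphisms are immersions / smooth embeddings. This file provides the criteria needed to
verify `Manifold.IsSmoothEmbedding` for concrete maps between *boundaryless* manifolds
(Lee, *Introduction to Smooth Manifolds* (2nd ed.), Prop. 4.8, Prop. 5.2, Thm. 4.14 for the
statements; the proofs here are chart bookkeeping):

* `Literature.Topology.FourManifolds.isImmersionAtOfComplement_of_eventuallyEq_openPartialHomeomorph`: if `f` agrees near `x`
  with an open partial homeomorphism `Φ : M ⇀ N` which is `C^n` with `C^n` inverse (a partial
  diffeomorphism), then `f` is an immersion at `x` (complement `PUnit`), given a linear
  identification `E ≃L E'` of the model vector spaces (equal dimension).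
* `Literature.Topology.FourManifolds.isSmoothEmbedding_of_openPartialHomeomorph`: a globally defined such `Φ` (source `univ`)
  is a smooth embedding; `Literature.Topology.FourManifolds.isSmoothEmbedding_diffeomorph_of_boundaryless`: so is a
  diffeomorphism between boundaryless manifolds with (possibly different) models on isomorphic
  vector spaces (the same-model companion, allowing boundary, is the tree's
  `Diffeomorph.isSmoothEmbedding'` in `CerfGammaFourProofs`).
* `Literature.Topology.FourManifolds.isImmersionAtOfComplement_of_eventuallyEq_prod`: if `f` agrees near `x` with the zero
  section `y ↦ Φ (y, 0)` of a partial diffeomorphism `Φ : M × F ⇀ N`, then `f` is an immersion at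
  `x` with complement `F` (the situation of a submanifold with a tubular neighbourhood).
* `Literature.Topology.FourManifolds.contMDiffOn_leftInverse_of_isImmersion`: a left inverse of an injective immersion which is
  a topological embedding is `C^n` on the range (in particular the inverse of an open smooth
  embedding is smooth).

All models with corners are assumed `Boundaryless`, so that `I.toHomeomorph : H ≃ₜ E` is available
to transport charts between different model spaces.
-/

open scoped Manifold ContDiff Topology
open Set Function OpenPartialHomeomorph

noncomputable section

namespace Literature.Topology.FourManifolds

variable {E H E' H' : Type*} [NormedAddCommGroup E] [NormedSpace ℝ E] [TopologicalSpace H]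
  [NormedAddCommGroup E'] [NormedSpace ℝ E'] [TopologicalSpace H']
  {I : ModelWithCorners ℝ E H} {J : ModelWithCorners ℝ E' H'}
  {M : Type*} [TopologicalSpace M] [ChartedSpace H M]
  {N : Type*} [TopologicalSpace N] [ChartedSpace H' N]
  {n : WithTop ℕ∞}

/-! ### Transporting the model space along a linear isomorphism -/

section ModelIso

variable [I.Boundaryless] [J.Boundaryless]

/-- The homeomorphism `H ≃ₜ H'` of boundaryless model spaces induced by a continuous linear
isomorphism `L : E ≃L E'` of the model vector spaces: `J.symm ∘ L ∘ I`. [folklore] -/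
def modelIso (I : ModelWithCorners ℝ E H) (J : ModelWithCorners ℝ E' H') [I.Boundaryless]
    [J.Boundaryless] (L : E ≃L[ℝ] E') : H ≃ₜ H' :=
  I.toHomeomorph.trans (L.toHomeomorph.trans J.toHomeomorph.symm)

/-- `modelIso I J L h = J.symm (L (I h))`. [folklore] -/
@[simp] theorem modelIso_apply (L : E ≃L[ℝ] E') (h : H) : modelIso I J L h = J.symm (L (I h)) := rfl

/-- `(modelIso I J L).symm h' = I.symm (L.symm (J h'))`. [folklore] -/
@[simp] theorem modelIso_symm_apply (L : E ≃L[ℝ] E') (h' : H') :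
    (modelIso I J L).symm h' = I.symm (L.symm (J h')) := rfl

omit [J.Boundaryless] in
/-- The inverse of a boundaryless model with corners is smooth on the whole model vector space
(the `ContMDiff` version, for boundaryless `I`, of Mathlib's `ModelWithCorners.contMDiffOn_symm`,
which is stated on `range I`). [folklore] -/
theorem contMDiff_modelWithCorners_symm : ContMDiff 𝓘(ℝ, E) I n I.symm := fun x ↦
  (I.contMDiffOn_symm x (I.range_eq_univ.symm ▸ mem_univ x)).contMDiffAt
    (I.range_eq_univ.symm ▸ Filter.univ_mem)

/-- `modelIso I J L` is smooth. [folklore] -/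
theorem contMDiff_modelIso (L : E ≃L[ℝ] E') : ContMDiff I J n (modelIso I J L) :=
  contMDiff_modelWithCorners_symm.comp (L.toContinuousLinearMap.contMDiff.comp I.contMDiff)

/-- `(modelIso I J L).symm` is smooth. [folklore] -/
theorem contMDiff_modelIso_symm (L : E ≃L[ℝ] E') : ContMDiff J I n (modelIso I J L).symm :=
  contMDiff_modelWithCorners_symm.comp (L.symm.toContinuousLinearMap.contMDiff.comp J.contMDiff)

end ModelIso

/-! ### Local diffeomorphisms are immersions (equal dimension) -/

section Codim0

variable [I.Boundaryless] [J.Boundaryless] [IsManifold I n M] [IsManifold J n N]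

variable (I J) in
/-- The chart of `N` transported from the chart `φ` of `M` along a partial homeomorphism
`Φ : M ⇀ N` and the model isomorphism `L`: `modelIso I J L ∘ φ ∘ Φ.symm`. [folklore] -/
def transportedChart (Φ : OpenPartialHomeomorph M N) (φ : OpenPartialHomeomorph M H)
    (L : E ≃L[ℝ] E') : OpenPartialHomeomorph N H' :=
  Φ.symm ≫ₕ φ.transHomeomorph (modelIso I J L)

omit [IsManifold I n M] in
/-- A chart transported along a partial diffeomorphism from a maximal-atlas chart is a
maximal-atlas chart (Lee, *Introduction to Smooth Manifolds*, Prop. 4.8: local diffeomorphisms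
preserve the smooth structure). [folklore] -/
theorem transportedChart_mem_maximalAtlas {Φ : OpenPartialHomeomorph M N}
    (hΦ : ContMDiffOn I J n Φ Φ.source) (hΦ' : ContMDiffOn J I n Φ.symm Φ.target)
    {φ : OpenPartialHomeomorph M H} (hφ : φ ∈ IsManifold.maximalAtlas I n M) (L : E ≃L[ℝ] E') :
    transportedChart I J Φ φ L ∈ IsManifold.maximalAtlas J n N := by
  set χ := transportedChart I J Φ φ L with hχdef
  refine χ.mem_maximalAtlas_of_contMDiffOn ?_ ?_
  · -- `χ = T ∘ φ ∘ Φ.symm`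
    have h1 : ContMDiffOn J I n Φ.symm χ.source := hΦ'.mono fun y hy ↦ hy.1
    have h2 : ContMDiffOn J I n (φ ∘ Φ.symm) χ.source :=
      (contMDiffOn_of_mem_maximalAtlas hφ).comp h1 fun y hy ↦ by
        simp only [hχdef, transportedChart, trans_source, transHomeomorph_source, mem_inter_iff,
          mem_preimage] at hy
        exact hy.2
    exact (contMDiff_modelIso L).comp_contMDiffOn h2
  · -- `χ.symm = Φ ∘ φ.symm ∘ T.symm`
    have h1 : ContMDiffOn J I n (φ.symm ∘ (modelIso I J L).symm) χ.target :=
      (contMDiffOn_symm_of_mem_maximalAtlas hφ).comp (contMDiff_modelIso_symm L).contMDiffOn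
        fun y hy ↦ by
          simp only [hχdef, transportedChart, trans_target, transHomeomorph_target, mem_inter_iff,
            mem_preimage] at hy
          exact hy.1
    exact hΦ.comp h1 fun y hy ↦ by
      simp only [hχdef, transportedChart, trans_target, transHomeomorph_target, mem_inter_iff,
        mem_preimage, transHomeomorph_symm_apply] at hy
      exact hy.2

/-- **A partial diffeomorphism is an immersion** (complement `PUnit`). If `f : M → N` agrees near
`x` with an open partial homeomorphism `Φ` which is `C^n` on its source with `C^n` inverse on its
target, `x ∈ Φ.source`, and the model vector spaces are identified by `L : E ≃L E'`, then `f` is a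
`C^n` immersion at `x`: in the charts `φ = chartAt x` (restricted to `Φ.source`) and
`χ = Φ.symm ≫ φ ≫ modelIso I J L` it reads `u ↦ L u`
(Lee, *Introduction to Smooth Manifolds*, Prop. 4.8). [folklore] -/
theorem isImmersionAtOfComplement_of_eventuallyEq_openPartialHomeomorph
    (Φ : OpenPartialHomeomorph M N) (hΦ : ContMDiffOn I J n Φ Φ.source)
    (hΦ' : ContMDiffOn J I n Φ.symm Φ.target) (L : E ≃L[ℝ] E') {f : M → N} {x : M}
    (hx : x ∈ Φ.source) (hf : f =ᶠ[𝓝 x] Φ) :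
    Manifold.IsImmersionAtOfComplement Unit I J n f x := by
  -- reduce to `f = Φ`
  suffices h : Manifold.IsImmersionAtOfComplement Unit I J n Φ x from
    h.congr_of_eventuallyEq hf.symm
  set φ := chartAt H x
  have hφ : φ.restr Φ.source ∈ IsManifold.maximalAtlas I n M :=
    restr_mem_maximalAtlas _ (IsManifold.chart_mem_maximalAtlas x) Φ.open_source
  refine Manifold.IsImmersionAtOfComplement.mk_of_continuousAt
    ((hΦ.continuousOn.continuousWithinAt hx).continuousAt (Φ.open_source.mem_nhds hx))
    ((ContinuousLinearEquiv.prodUnique ℝ E Unit).trans L) (φ.restr Φ.source)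
    (transportedChart I J Φ φ L) ?_ ?_ hφ
    (transportedChart_mem_maximalAtlas hΦ hΦ' (IsManifold.chart_mem_maximalAtlas x) L) ?_
  · rw [φ.restr_source' _ Φ.open_source]
    exact ⟨mem_chart_source H x, hx⟩
  · simp only [transportedChart, trans_source, mem_inter_iff, mem_preimage, transHomeomorph_source]
    exact ⟨Φ.map_source hx, by rw [Φ.left_inv hx]; exact mem_chart_source H x⟩
  · intro u hu
    simp only [extend_target, mem_inter_iff, mem_preimage, restr_target,
      Φ.open_source.interior_eq] at hu
    obtain ⟨⟨hu1, hu2⟩, -⟩ := hu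
    simp only [comp_apply, extend_coe, extend_coe_symm, transportedChart, coe_trans,
      transHomeomorph_apply, ContinuousLinearEquiv.trans_apply, restr_symm_apply,
      ContinuousLinearEquiv.prodUnique_apply, modelIso_apply]
    rw [Φ.left_inv hu2, φ.right_inv hu1, I.right_inv (I.range_eq_univ.symm ▸ mem_univ u),
      J.right_inv (J.range_eq_univ.symm ▸ mem_univ _)]

/-- **A globally defined partial diffeomorphism is a smooth embedding**: if
`Φ : OpenPartialHomeomorph M N` has source `univ` and is `C^n` with `C^n` inverse, and the model
vector spaces have the same dimension (`L : E ≃L E'`), then `Φ : M → N` is a `C^n` embedding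
(Lee, *Introduction to Smooth Manifolds*, Prop. 5.2). Its range `Φ.target` is moreover open:
`Φ.to_isOpenEmbedding hsrc` (Mathlib). [folklore] -/
theorem isSmoothEmbedding_of_openPartialHomeomorph (Φ : OpenPartialHomeomorph M N)
    (hsrc : Φ.source = univ) (hΦ : ContMDiffOn I J n Φ Φ.source)
    (hΦ' : ContMDiffOn J I n Φ.symm Φ.target) (L : E ≃L[ℝ] E') :
    Manifold.IsSmoothEmbedding I J n Φ :=
  ⟨Manifold.IsImmersionOfComplement.isImmersion fun x ↦
      isImmersionAtOfComplement_of_eventuallyEq_openPartialHomeomorph Φ hΦ hΦ' L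
        (hsrc ▸ mem_univ x) Filter.EventuallyEq.rfl,
    (Φ.to_isOpenEmbedding hsrc).isEmbedding⟩

/-- **A diffeomorphism between boundaryless manifolds is a smooth embedding** (Mathlib
`proof_wanted Diffeomorph.isSmoothEmbedding`, here for two possibly different boundaryless models
`I`, `J` whose model vector spaces are identified by `L : E ≃L E'`). The same-model case `I = J`,
without boundarylessness, is the tree's dot-notation lemma `Diffeomorph.isSmoothEmbedding'`
(`Literature.Topology.FourManifolds.CerfGammaFourProofs`); neither subsumes the other. [folklore] -/
theorem isSmoothEmbedding_diffeomorph_of_boundaryless (e : M ≃ₘ^n⟮I, J⟯ N) (L : E ≃L[ℝ] E') :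
    Manifold.IsSmoothEmbedding I J n e :=
  isSmoothEmbedding_of_openPartialHomeomorph e.toHomeomorph.toOpenPartialHomeomorph rfl
    e.contMDiff.contMDiffOn e.symm.contMDiff.contMDiffOn L

end Codim0

/-! ### Zero sections of product neighbourhoods are immersions -/

section ZeroSection

variable [I.Boundaryless] [J.Boundaryless] [IsManifold I n M] [IsManifold J n N]
  {F : Type*} [NormedAddCommGroup F] [NormedSpace ℝ F]

/-- **The zero section of a product neighbourhood is an immersion.** Let `Φ : M × F ⇀ N` be an
open partial homeomorphism, `C^n` with `C^n` inverse, with `(x, 0) ∈ Φ.source`, and let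
`L : E × F ≃L E'` identify the models. If `f : M → N` agrees near `x` with `y ↦ Φ (y, 0)` then `f`
is a `C^n` immersion at `x` with complement `F`: in the charts `φ = chartAt x` (suitably
restricted) and `Φ.symm ≫ chartAt (x, 0) ≫ modelIso` it reads `u ↦ L (u, 0)`. This is how a
submanifold given as the zero section of a tubular neighbourhood is seen to be embedded
(Lee, *Introduction to Smooth Manifolds*, Thm. 5.8 / Prop. 5.2). [folklore] -/
theorem isImmersionAtOfComplement_of_eventuallyEq_prod (Φ : OpenPartialHomeomorph (M × F) N)
    (hΦ : ContMDiffOn (I.prod 𝓘(ℝ, F)) J n Φ Φ.source)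
    (hΦ' : ContMDiffOn J (I.prod 𝓘(ℝ, F)) n Φ.symm Φ.target) (L : (E × F) ≃L[ℝ] E')
    {f : M → N} {x : M} (hx : (x, 0) ∈ Φ.source) (hf : f =ᶠ[𝓝 x] fun y ↦ Φ (y, 0)) :
    Manifold.IsImmersionAtOfComplement F I J n f x := by
  suffices h : Manifold.IsImmersionAtOfComplement F I J n (fun y ↦ Φ (y, 0)) x from
    h.congr_of_eventuallyEq hf.symm
  set φ := chartAt H x
  set ψ : OpenPartialHomeomorph (M × F) (ModelProd H F) := chartAt (ModelProd H F) (x, (0 : F))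
  -- the open set of `y` with `(y, 0)` in the source of `Φ`
  set s : Set M := (fun y ↦ (y, (0 : F))) ⁻¹' Φ.source with hs
  have hso : IsOpen s := Φ.open_source.preimage (by fun_prop)
  have hφ : φ.restr s ∈ IsManifold.maximalAtlas I n M :=
    restr_mem_maximalAtlas _ (IsManifold.chart_mem_maximalAtlas x) hso
  have hcont : ContinuousAt (fun y ↦ Φ (y, 0)) x := by
    have h1 : ContinuousAt Φ (x, (0 : F)) :=
      (hΦ.continuousOn.continuousWithinAt hx).continuousAt (Φ.open_source.mem_nhds hx)
    have h2 : Continuous fun y : M ↦ ((y, (0 : F)) : M × F) := by fun_prop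
    exact ContinuousAt.comp (g := Φ) (f := fun y : M ↦ ((y, (0 : F)) : M × F)) h1 h2.continuousAt
  refine Manifold.IsImmersionAtOfComplement.mk_of_continuousAt hcont L (φ.restr s)
    (transportedChart (I.prod 𝓘(ℝ, F)) J Φ ψ L) ?_ ?_ hφ
    (transportedChart_mem_maximalAtlas hΦ hΦ' (IsManifold.chart_mem_maximalAtlas _) L) ?_
  · rw [φ.restr_source' _ hso]
    exact ⟨mem_chart_source H x, hx⟩
  · simp only [transportedChart, trans_source, mem_inter_iff, mem_preimage,
      transHomeomorph_source]
    refine ⟨Φ.map_source hx, ?_⟩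
    rw [Φ.left_inv hx]
    exact mem_chart_source _ _
  · intro u hu
    simp only [extend_target, mem_inter_iff, mem_preimage, restr_target, hso.interior_eq] at hu
    obtain ⟨⟨hu1, hu2⟩, -⟩ := hu
    simp only [hs, mem_preimage] at hu2
    simp only [comp_apply, extend_coe, extend_coe_symm, transportedChart, coe_trans,
      transHomeomorph_apply, restr_symm_apply, modelIso_apply]
    rw [Φ.left_inv hu2, J.right_inv (J.range_eq_univ.symm ▸ mem_univ _)]
    congr 1
    have hψ : (I.prod 𝓘(ℝ, F)) (ψ (φ.symm (I.symm u), 0)) =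
        extChartAt (I.prod 𝓘(ℝ, F)) (x, (0 : F)) (φ.symm (I.symm u), 0) := rfl
    rw [hψ, extChartAt_prod, PartialEquiv.prod_coe]
    change (I (φ (φ.symm (I.symm u))), extChartAt 𝓘(ℝ, F) (0 : F) 0) = (u, 0)
    rw [φ.right_inv hu1, I.right_inv (I.range_eq_univ.symm ▸ mem_univ u), extChartAt_self_apply]
    rfl

end ZeroSection

/-! ### Inverses of embeddings which are immersions -/

section Inverse

/-- **A left inverse of an injective immersion which is a topological embedding is `C^n` on the
range.** In the immersion charts `φ`, `χ` around `m` and `f m` one has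
`χ.extend J (f y) = L (φ.extend I y, 0)`, so a left inverse `g` is
`(φ.extend I).symm ∘ pr₁ ∘ L.symm ∘ χ.extend J` on `f '' φ.source`, which is relatively open in
`range f` because `f` is an embedding. In particular the inverse of an open smooth embedding
(e.g. of a tubular neighbourhood map) is smooth on its (open) range
(Lee, *Introduction to Smooth Manifolds*, Prop. 5.2 / Thm. 4.14). [folklore] -/
theorem contMDiffOn_leftInverse_of_isImmersion {f : M → N} (hf : Manifold.IsImmersion I J n f)
    (hemb : Topology.IsEmbedding f) {g : N → M} (hg : LeftInverse g f) :
    ContMDiffOn J I n g (range f) := by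
  obtain ⟨F, _, _, hF⟩ := hf
  refine contMDiffOn_of_locally_contMDiffOn fun y hy ↦ ?_
  obtain ⟨m, rfl⟩ := hy
  have hm := hF m
  -- an open `u ⊆ N` with `range f ∩ u = f '' φ.source`
  obtain ⟨u, hu, hfu⟩ := hemb.isInducing.isOpen_iff.1 hm.domChart.open_source
  refine ⟨u, hu, ?_, ?_⟩
  · have : m ∈ f ⁻¹' u := hfu.symm ▸ hm.mem_domChart_source
    exact this
  rw [← image_preimage_eq_range_inter, hfu]
  -- the formula `φ.extend I y = (L.symm (χ.extend J (f y))).1` on `φ.source`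
  have key : ∀ y ∈ hm.domChart.source,
      (hm.equiv.symm (hm.codChart.extend J (f y))).1 = hm.domChart.extend I y := by
    intro y hy
    have hy' : y ∈ (hm.domChart.extend I).source := by rwa [extend_source]
    have hw := hm.writtenInCharts ((hm.domChart.extend I).map_source hy')
    simp only [comp_apply, (hm.domChart.extend I).left_inv hy'] at hw
    rw [hw, ContinuousLinearEquiv.symm_apply_apply]
  -- the honest local inverse
  have heq : EqOn g ((hm.domChart.extend I).symm ∘ Prod.fst ∘ hm.equiv.symm ∘ hm.codChart.extend J)
      (f '' hm.domChart.source) := by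
    rintro _ ⟨y, hy, rfl⟩
    have hy' : y ∈ (hm.domChart.extend I).source := by rwa [extend_source]
    simp only [comp_apply, hg y, key y hy, (hm.domChart.extend I).left_inv hy']
  refine ContMDiffOn.congr ?_ heq
  have h1 : ContMDiffOn J 𝓘(ℝ, E') n (hm.codChart.extend J) (f '' hm.domChart.source) :=
    (hm.codChart.contMDiffOn_extend hm.codChart_mem_maximalAtlas).mono (by
      rintro _ ⟨y, hy, rfl⟩; exact hm.source_subset_preimage_source hy)
  have h2 : ContMDiffOn J 𝓘(ℝ, E) n (Prod.fst ∘ hm.equiv.symm ∘ hm.codChart.extend J)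
      (f '' hm.domChart.source) := by
    have : ContMDiff 𝓘(ℝ, E') 𝓘(ℝ, E) n (Prod.fst ∘ (hm.equiv.symm : E' → E × F)) := by
      rw [contMDiff_iff_contDiff]
      exact contDiff_fst.comp hm.equiv.symm.contDiff
    exact this.comp_contMDiffOn h1
  refine (contMDiffOn_extend_symm hm.domChart_mem_maximalAtlas).comp h2 ?_
  rintro _ ⟨y, hy, rfl⟩
  show (hm.equiv.symm (hm.codChart.extend J (f y))).1 ∈ I '' hm.domChart.target
  rw [key y hy, extend_coe]
  exact mem_image_of_mem _ (hm.domChart.map_source hy)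

/-- The inverse of an open smooth embedding, as an open partial homeomorphism, is smooth on the
range. [folklore] -/
theorem contMDiffOn_symm_of_isSmoothEmbedding [Nonempty M] {f : M → N}
    (hf : Manifold.IsSmoothEmbedding I J n f) (ho : Topology.IsOpenEmbedding f) :
    ContMDiffOn J I n (ho.toOpenPartialHomeomorph f).symm (range f) :=
  contMDiffOn_leftInverse_of_isImmersion hf.isImmersion hf.isEmbedding fun _ ↦
    ho.toOpenPartialHomeomorph_left_inv

end Inverse

end Literature.Topology.FourManifolds
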